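import Summits.CriticalPhenomena.SAWScalingLimit.Theorems.AnnularMassDecay.Negative.LoadBearing

/-!
# The last-renewal cut of the chain-stopped mass, I: profiles and the abstract bijection

Line `radial-renewal-kesten-inequality` of the crux `AnnularMassDecay` (stmt-CriticalPhenomena-4729),
support for the OPEN stub S2 `stub_deathSeed` (`∃ A > 1, ε > 0, D(u; ρ_u/A)[N] ≤ 1 - ε`, where
`ρ_v = dist (Site.toComplex v) z` and `D(u;s)[N]` is the `x_c`-mass of the chain-stopped family at
level `s` from `u`: self-avoiding `ω` of length `0 < n ≤ N`, confined to the open disc of radius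
`ρ_u` about `z` after time `0`, whose end is a strict radial record of radius `≤ s`, and none of
whose radial renewal times `0 < t < n` — strict records whose whole future is strictly closer to
`z` — has radius `≤ s`).  The exact structure behind S2 is the LAST-RENEWAL CUT: a level-`s` member
factorises uniquely at its last radial renewal time `t` (or `t = 0` if it has none) into a
record-ending confined prefix with end radius `> s` and a radially IRREDUCIBLE descent (no renewal
time at all) from `w = u + ω t`, confined to the open disc of radius `ρ_w`; conversely every such
pair concatenates to a member.  This file holds the two model-independent halves of that argument:

* the membership clauses, which only involve the radius profile `i ↦ ρ_{u + ω i}`, proved for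
  real sequences: `rr_lr_profile_cutTime` (the cut time is `< n`, a strict record with closer
  future, of radius `> s`), `rr_lr_profile_prefix`, `rr_lr_profile_suffix` (the suffix has no
  renewal: it would be a later renewal of the whole profile), `rr_lr_profile_concat` (the
  concatenated profile is a member, `m` is a renewal time and the last one);
* the finite-sum bookkeeping `rr_lr_abstract_bijection` (registered helper): over abstract finite
  sets, if cutting a member at the last admissible time and concatenating admissible pairs are
  mutually inverse (`Nat.findGreatest`, `Finset.sum_nbij'`), the `x^n`-weighted count of members
  equals `Σ_prefixes x^m · Σ_suffixes x^k`.

The walk-level identity `D(u;s)[N] = Σ_η x_c^{|η|} Irr_{≤ s}(u + η_m)[N]` and the mass balance of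
the radial renewal chain are in `…LastRenewalBalance.lean`.  No definitions here.
Sources: H. Kesten, J. Math. Phys. 4 (1963) (irreducible bridges, renewal structure);
N. Madras, G. Slade, *The Self-Avoiding Walk* (1993) §1.2, §4.2. [folklore]
-/

noncomputable section

namespace Summit.CriticalPhenomena.SAWScalingLimit.Theorems.AnnularMassDecay.Radial

open scoped BigOperators Classical

/-! ### Radius profiles -/

/-- **The cut time.** For a profile confined below `ρ = r 0` after time `0` whose renewals before
the end have radius `> s` (`s < ρ`), a time `t` which is either `0` or a radial renewal time
`0 < t < n` satisfies: `t < n`, `t` is a strict record, its future is closer, and `s < r t`.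
[folklore] -/
theorem rr_lr_profile_cutTime {r : ℕ → ℝ} {ρ s : ℝ} {n t : ℕ} (h0 : r 0 = ρ) (hs : s < ρ)
    (hn : 0 < n) (hconf : ∀ i, 0 < i → i ≤ n → r i < ρ)
    (hren : ∀ t', 0 < t' → t' < n → (∀ i, i < t' → r t' < r i) →
      (∀ j, t' < j → j ≤ n → r j < r t') → s < r t')
    (hgood : t ≠ 0 → 0 < t ∧ t < n ∧ (∀ i, i < t → r t < r i) ∧
      (∀ j, t < j → j ≤ n → r j < r t)) :
    t < n ∧ (∀ i, i < t → r t < r i) ∧ (∀ j, t < j → j ≤ n → r j < r t) ∧ s < r t := by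
  rcases Nat.eq_zero_or_pos t with rfl | ht
  · refine ⟨hn, fun i hi => absurd hi (Nat.not_lt_zero i), fun j hj hjn => ?_, by rwa [h0]⟩
    rw [h0]
    exact hconf j hj hjn
  · obtain ⟨-, htn, hrec, hfut⟩ := hgood ht.ne'
    exact ⟨htn, hrec, hfut, hren t ht htn hrec hfut⟩

/-- **Prefix of the last-renewal cut, on profiles.** A profile `r'` agreeing with `r` on `[0, t]`,
where `t ≤ n` is a strict record of radius `> s` of a profile confined below `ρ`, is record-ending,
confined below `ρ`, with end radius `> s`. [folklore] -/
theorem rr_lr_profile_prefix {r r' : ℕ → ℝ} {ρ s : ℝ} {n t : ℕ}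
    (hconf : ∀ i, 0 < i → i ≤ n → r i < ρ) (htn : t ≤ n) (hrec : ∀ i, i < t → r t < r i)
    (hst : s < r t) (hr' : ∀ i, i ≤ t → r' i = r i) :
    s < r' t ∧ (∀ i, 0 < i → i ≤ t → r' i < ρ) ∧ (∀ i, i < t → r' t < r' i) := by
  have hrt : r' t = r t := hr' t le_rfl
  refine ⟨by rwa [hrt], fun i hi hit => ?_, fun i hit => ?_⟩
  · rw [hr' i hit]
    exact hconf i hi (hit.trans htn)
  · rw [hrt, hr' i hit.le]
    exact hrec i hit

/-- **Suffix of the last-renewal cut, on profiles.** `t < n` is a strict record with closer future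
and NO radial renewal time of `r` lies in `(t, n)`; then a profile `r''` with `r'' i = r (t + i)` on
`[0, n - t]` is a radially irreducible descent about the base radius `ρw = r t`: positive length,
confined below `ρw` after time `0`, end = strict record of radius `≤ ρw`, and no renewal time at
all (a renewal `t'` of `r''` would be the renewal `t + t'` of `r`), the end predicate `Q` being
transported. [folklore] -/
theorem rr_lr_profile_suffix {r r'' : ℕ → ℝ} {ρw : ℝ} {n t : ℕ} (Q : ℝ → Prop)
    (hend : ∀ i, i < n → r n < r i) (hQ : Q (r n)) (htn : t < n)
    (hrec : ∀ i, i < t → r t < r i) (hfut : ∀ j, t < j → j ≤ n → r j < r t)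
    (hno : ∀ t', t < t' → t' ≤ n → ¬ (0 < t' ∧ t' < n ∧ (∀ i, i < t' → r t' < r i) ∧
      (∀ j, t' < j → j ≤ n → r j < r t')))
    (hρw : ρw = r t) (hr'' : ∀ i, i ≤ n - t → r'' i = r (t + i)) :
    Q (r'' (n - t)) ∧ 0 < n - t ∧ (∀ i, 0 < i → i ≤ n - t → r'' i < ρw) ∧
      (∀ i, i < n - t → r'' (n - t) < r'' i) ∧ r'' (n - t) ≤ ρw ∧
      (∀ t', 0 < t' → t' < n - t → (∀ i, i < t' → r'' t' < r'' i) →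
        (∀ j, t' < j → j ≤ n - t → r'' j < r'' t') → ρw < r'' t') := by
  have hm : r'' (n - t) = r n := by rw [hr'' _ le_rfl, Nat.add_sub_of_le htn.le]
  refine ⟨by rwa [hm], Nat.sub_pos_of_lt htn, ?_, ?_, ?_, ?_⟩
  · intro i hi him
    rw [hr'' i him, hρw]
    exact hfut (t + i) (by omega) (by omega)
  · intro i him
    rw [hm, hr'' i him.le]
    exact hend (t + i) (by omega)
  · rw [hm, hρw]
    exact (hfut n htn le_rfl).le
  · intro t' h0 ht' hrec' hfut'
    exfalso
    refine hno (t + t') (by omega) (by omega) ⟨by omega, by omega, ?_, ?_⟩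
    · intro i hi
      rcases lt_or_ge i t with hit | hit
      · exact (hfut (t + t') (by omega) (by omega)).trans (hrec i hit)
      · obtain ⟨k, rfl⟩ : ∃ k, i = t + k := ⟨i - t, by omega⟩
        have h := hrec' k (by omega)
        rwa [hr'' t' ht'.le, hr'' k (by omega)] at h
    · intro j htj hjn
      obtain ⟨k, rfl⟩ : ∃ k, j = t + k := ⟨j - t, by omega⟩
      have h := hfut' k (by omega) (by omega)
      rwa [hr'' k (by omega), hr'' t' ht'.le] at h

/-- **Concatenation, on profiles.** `rη`: a record-ending profile of length `m` confined below
`ρ = rη 0` after time `0` with end radius `> s`; `rσ`: an irreducible descent of positive length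
`k` about the base radius `rη m` (confined below it after time `0`, end = strict record, no renewal
time at all) whose end satisfies `Q`; `rω`: a profile equal to `rη` on `[0, m]` and to `rσ (· - m)`
on `[m, m + k]`.  Then `rω` is a level-`s` member profile of length `m + k` with end predicate `Q`
(positive length, confined, end = strict record, every renewal of radius `> s`), `m` is — if
nonzero — a renewal time of `rω`, and `rω` has no renewal time in `(m, m + k]`. [folklore] -/
theorem rr_lr_profile_concat {rη rσ rω : ℕ → ℝ} {ρ s : ℝ} {m k : ℕ} (Q : ℝ → Prop)
    (hη0 : rη 0 = ρ) (hconfη : ∀ i, 0 < i → i ≤ m → rη i < ρ)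
    (hendη : ∀ i, i < m → rη m < rη i) (hs : s < rη m) (hk : 0 < k)
    (hconfσ : ∀ i, 0 < i → i ≤ k → rσ i < rη m) (hendσ : ∀ i, i < k → rσ k < rσ i)
    (hQ : Q (rσ k))
    (hrenσ : ∀ t, 0 < t → t < k → (∀ i, i < t → rσ t < rσ i) →
      (∀ j, t < j → j ≤ k → rσ j < rσ t) → rη m < rσ t)
    (h1 : ∀ i, i ≤ m → rω i = rη i) (h2 : ∀ i, i ≤ k → rω (m + i) = rσ i) :
    (0 < m + k ∧ (∀ i, 0 < i → i ≤ m + k → rω i < ρ) ∧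
      (∀ i, i < m + k → rω (m + k) < rω i) ∧ Q (rω (m + k)) ∧
      (∀ t, 0 < t → t < m + k → (∀ i, i < t → rω t < rω i) →
        (∀ j, t < j → j ≤ m + k → rω j < rω t) → s < rω t)) ∧
    (m ≠ 0 → 0 < m ∧ m < m + k ∧ (∀ i, i < m → rω m < rω i) ∧
      (∀ j, m < j → j ≤ m + k → rω j < rω m)) ∧
    (∀ t, m < t → t ≤ m + k → ¬ (0 < t ∧ t < m + k ∧ (∀ i, i < t → rω t < rω i) ∧
      (∀ j, t < j → j ≤ m + k → rω j < rω t))) := by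
  have hωm : rω m = rη m := h1 m le_rfl
  have hωe : rω (m + k) = rσ k := h2 k le_rfl
  -- radii up to time `m` are `≥ rη m`, radii after time `m` are `< rη m`
  have hge : ∀ i, i ≤ m → rη m ≤ rω i := by
    intro i hi
    rw [h1 i hi]
    rcases hi.lt_or_eq with hlt | rfl
    · exact (hendη i hlt).le
    · exact le_rfl
  have hlt : ∀ i, m < i → i ≤ m + k → rω i < rη m := by
    intro i hmi hik
    obtain ⟨j, rfl⟩ : ∃ j, i = m + j := ⟨i - m, by omega⟩
    rw [h2 j (by omega)]
    exact hconfσ j (by omega) (by omega)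
  -- no renewal of the concatenation after time `m`: it would be a renewal of `rσ`
  have hno : ∀ t, m < t → t < m + k → (∀ i, i < t → rω t < rω i) →
      (∀ j, t < j → j ≤ m + k → rω j < rω t) → False := by
    intro t hmt htk hrec hfut
    obtain ⟨t', rfl⟩ : ∃ t', t = m + t' := ⟨t - m, by omega⟩
    have h3 := hconfσ t' (by omega) (by omega)
    have key := hrenσ t' (by omega) (by omega) ?_ ?_
    · exact lt_asymm key h3
    · intro i hi
      have h := hrec (m + i) (by omega)
      rwa [h2 t' (by omega), h2 i (by omega)] at h
    · intro j htj hjk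
      have h := hfut (m + j) (by omega) (by omega)
      rwa [h2 j hjk, h2 t' (by omega)] at h
  refine ⟨⟨by omega, ?_, ?_, by rwa [hωe], ?_⟩,
    fun hm0 => ⟨Nat.pos_of_ne_zero hm0, by omega, ?_, ?_⟩,
    fun t hmt _ hG => hno t hmt hG.2.1 hG.2.2.1 hG.2.2.2⟩
  · -- confined below `ρ`
    intro i hi hik
    rcases le_or_gt i m with him | him
    · rw [h1 i him]
      exact hconfη i hi him
    · have hρ : rη m ≤ ρ := by
        rcases Nat.eq_zero_or_pos m with rfl | hm
        · exact hη0.le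
        · exact (hconfη m hm le_rfl).le
      exact (hlt i him hik).trans_le hρ
  · -- the end is a strict record
    intro i hik
    rw [hωe]
    rcases le_or_gt i m with him | him
    · exact (hconfσ k hk le_rfl).trans_le (hge i him)
    · obtain ⟨j, rfl⟩ : ∃ j, i = m + j := ⟨i - m, by omega⟩
      rw [h2 j (by omega)]
      exact hendσ j (by omega)
  · -- every renewal has radius `> s`
    intro t _ htk hrec hfut
    rcases le_or_gt t m with htm | htm
    · exact hs.trans_le (hge t htm)
    · exact (hno t htm htk hrec hfut).elim
  · -- `m` is a strict record
    intro i him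
    rw [hωm, h1 i him.le]
    exact hendη i him
  · -- its future is closer
    intro j hmj hjk
    rw [hωm]
    exact hlt j hmj hjk

/-! ### Finite-sum bookkeeping: the abstract bijection -/

/-- **Abstract last-renewal bijection** (registered helper `rr_lr_abstract_bijection` for
`stub_deathSeed`).  `S n` are finite sets ("walks of length `n`"), `C` the
members, `P` the admissible prefixes, `C' m η k σ` the admissible suffixes of a prefix, `Good n ω t`
the admissible cut times, `pre`/`suf` the two pieces of the cut at time `t`, `conc m η σ` the
concatenation.  If members have length `≤ N` (`hlen`); cutting a member at a time `t ≤ n` which is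
admissible or `0` and after which no time is admissible yields a `P`-prefix of length `t` and a
`C'`-suffix of length `n - t` whose concatenation is the member (`hcut`); and the concatenation of
a `P`-prefix of length `m` with a `C'`-suffix of length `k` is a member of length `m + k` for which
`m` is admissible-or-`0` and no later time is admissible, with pieces the given ones (`hconc`):
then the `x^n`-weighted count of members of length `≤ N` equals
`Σ_{P-prefixes, m ≤ N} x^m · Σ_{C'-suffixes, k ≤ N} x^k` (cut at the LAST admissible time,
`Nat.findGreatest`; `Finset.sum_nbij'`). [folklore] -/
theorem rr_lr_abstract_bijection :
    ∀ {α : Type} (x : ℝ) (N : ℕ) (S : ℕ → Finset α) (C P : ℕ → α → Prop)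
      (C' : ℕ → α → ℕ → α → Prop) (Good : ℕ → α → ℕ → Prop)
      {instC : ∀ n, DecidablePred (C n)} {instP : ∀ n, DecidablePred (P n)}
      {instC' : ∀ m η k, DecidablePred (C' m η k)}
      (pre suf : ℕ → α → ℕ → α) (conc : ℕ → α → α → α),
      (∀ n ω, ω ∈ S n → C n ω → n ≤ N) →
      (∀ n ω t, ω ∈ S n → C n ω → t ≤ n → (t ≠ 0 → Good n ω t) →
        (∀ t', t < t' → t' ≤ n → ¬ Good n ω t') →
        pre n ω t ∈ S t ∧ P t (pre n ω t) ∧ suf n ω t ∈ S (n - t) ∧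
          C' t (pre n ω t) (n - t) (suf n ω t) ∧ conc t (pre n ω t) (suf n ω t) = ω) →
      (∀ m η k σ, η ∈ S m → P m η → σ ∈ S k → C' m η k σ →
        conc m η σ ∈ S (m + k) ∧ C (m + k) (conc m η σ) ∧ (m ≠ 0 → Good (m + k) (conc m η σ) m) ∧
          (∀ t', m < t' → t' ≤ m + k → ¬ Good (m + k) (conc m η σ) t') ∧
          pre (m + k) (conc m η σ) m = η ∧ suf (m + k) (conc m η σ) m = σ) →
      ∑ n ∈ Finset.range (N + 1), ∑ _ω ∈ (S n).filter (C n), x ^ n =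
        ∑ m ∈ Finset.range (N + 1), ∑ η ∈ (S m).filter (P m),
          x ^ m * (∑ k ∈ Finset.range (N + 1), ∑ _σ ∈ (S k).filter (C' m η k), x ^ k) := by
  intro α x N S C P C' Good instC instP instC' pre suf conc hlen hcut hconc
  classical
  have eL : ∑ n ∈ Finset.range (N + 1), ∑ _ω ∈ (S n).filter (C n), x ^ n =
      ∑ p ∈ (Finset.range (N + 1)).sigma (fun n => (S n).filter (C n)), x ^ p.1 :=
    Finset.sum_sigma' _ _ fun n _ => x ^ n
  have eP : (∑ m ∈ Finset.range (N + 1), ∑ η ∈ (S m).filter (P m),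
        x ^ m * (∑ k ∈ Finset.range (N + 1), ∑ _σ ∈ (S k).filter (C' m η k), x ^ k)) =
      ∑ y ∈ ((Finset.range (N + 1)).sigma (fun m => (S m).filter (P m))).sigma
          (fun q => (Finset.range (N + 1)).sigma (fun k => (S k).filter (C' q.1 q.2 k))),
        x ^ y.1.1 * x ^ y.2.1 := by
    rw [Finset.sum_sigma, Finset.sum_sigma]
    refine Finset.sum_congr rfl fun m _ => Finset.sum_congr rfl fun η _ => ?_
    rw [Finset.mul_sum, Finset.sum_sigma]
    refine Finset.sum_congr rfl fun k _ => ?_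
    rw [Finset.mul_sum]
  rw [eL, eP]
  symm
  -- `T n ω`: the last admissible cut time (`0` if there is none)
  obtain ⟨T, hT⟩ : ∃ T : ℕ → α → ℕ, ∀ n ω, T n ω ≤ n ∧ (T n ω ≠ 0 → Good n ω (T n ω)) ∧
      ∀ ⦃t'⦄, T n ω < t' → t' ≤ n → ¬ Good n ω t' :=
    ⟨fun n ω => Nat.findGreatest (Good n ω) n, fun n ω => Nat.findGreatest_eq_iff.1 rfl⟩
  have hTeq : ∀ n ω m, m ≤ n → (m ≠ 0 → Good n ω m) → (∀ t', m < t' → t' ≤ n → ¬ Good n ω t') →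
      T n ω = m := by
    intro n ω m hmn hgm hnm
    obtain ⟨hTn, hgT, hnT⟩ := hT n ω
    by_contra hne
    rcases lt_or_gt_of_ne hne with hlt | hgt
    · exact hnT hlt hmn (hgm (by omega))
    · exact hnm _ hgt hTn (hgT (by omega))
  refine Finset.sum_nbij'
    (fun y => (⟨y.1.1 + y.2.1, conc y.1.1 y.1.2 y.2.2⟩ : Σ _ : ℕ, α))
    (fun p => (⟨⟨T p.1 p.2, pre p.1 p.2 (T p.1 p.2)⟩, ⟨p.1 - T p.1 p.2, suf p.1 p.2 (T p.1 p.2)⟩⟩ :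
      Σ _ : (Σ _ : ℕ, α), (Σ _ : ℕ, α)))
    ?_ ?_ ?_ ?_ ?_
  · -- the concatenation is a member
    rintro ⟨⟨m, η⟩, ⟨k, σ⟩⟩ hy
    simp only [Finset.mem_sigma, Finset.mem_filter, Finset.mem_range] at hy
    obtain ⟨⟨-, hη, hPη⟩, -, hσ, hC'σ⟩ := hy
    obtain ⟨hS, hC, -⟩ := hconc m η k σ hη hPη hσ hC'σ
    simp only [Finset.mem_sigma, Finset.mem_filter, Finset.mem_range]
    exact ⟨Nat.lt_succ_of_le (hlen _ _ hS hC), hS, hC⟩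
  · -- the cut pieces are an admissible pair
    rintro ⟨n, ω⟩ hp
    simp only [Finset.mem_sigma, Finset.mem_filter, Finset.mem_range] at hp
    obtain ⟨hn, hS, hC⟩ := hp
    obtain ⟨hTn, hgT, hnT⟩ := hT n ω
    obtain ⟨h1, h2, h3, h4, -⟩ := hcut n ω _ hS hC hTn hgT fun t' a b => hnT a b
    simp only [Finset.mem_sigma, Finset.mem_filter, Finset.mem_range]
    exact ⟨⟨by omega, h1, h2⟩, by omega, h3, h4⟩
  · -- cut ∘ concatenation = id
    rintro ⟨⟨m, η⟩, ⟨k, σ⟩⟩ hy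
    simp only [Finset.mem_sigma, Finset.mem_filter, Finset.mem_range] at hy
    obtain ⟨⟨-, hη, hPη⟩, -, hσ, hC'σ⟩ := hy
    obtain ⟨-, -, hgm, hnm, hpre, hsuf⟩ := hconc m η k σ hη hPη hσ hC'σ
    have hTm : T (m + k) (conc m η σ) = m := hTeq _ _ m (by omega) hgm hnm
    show (⟨⟨T (m + k) (conc m η σ), pre (m + k) (conc m η σ) (T (m + k) (conc m η σ))⟩,
        ⟨m + k - T (m + k) (conc m η σ), suf (m + k) (conc m η σ) (T (m + k) (conc m η σ))⟩⟩ :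
        Σ _ : (Σ _ : ℕ, α), (Σ _ : ℕ, α)) = ⟨⟨m, η⟩, ⟨k, σ⟩⟩
    rw [hTm, hpre, hsuf, Nat.add_sub_cancel_left]
  · -- concatenation ∘ cut = id
    rintro ⟨n, ω⟩ hp
    simp only [Finset.mem_sigma, Finset.mem_filter, Finset.mem_range] at hp
    obtain ⟨-, hS, hC⟩ := hp
    obtain ⟨hTn, hgT, hnT⟩ := hT n ω
    obtain ⟨-, -, -, -, h5⟩ := hcut n ω _ hS hC hTn hgT fun t' a b => hnT a b
    show (⟨T n ω + (n - T n ω), conc (T n ω) (pre n ω (T n ω)) (suf n ω (T n ω))⟩ : Σ _ : ℕ, α) =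
      ⟨n, ω⟩
    rw [h5, Nat.add_sub_of_le hTn]
  · -- weights multiply
    rintro ⟨⟨m, η⟩, ⟨k, σ⟩⟩ _
    exact (pow_add x m k).symm

end Summit.CriticalPhenomena.SAWScalingLimit.Theorems.AnnularMassDecay.Radial

end
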